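import Summits.BirchSwinnertonDyer.BirchSwinnertonDyer.Theorems.ByReductionTypeAtTwoAdditivePotGoodPrintZhaiIrreducibleUnramified
import Summits.BirchSwinnertonDyer.BirchSwinnertonDyer.Theorems.Rank2ObservatoryTateDeepCert
import Summits.BirchSwinnertonDyer.BirchSwinnertonDyer.Theorems.Rank2ObservatoryTateStep2Cert
import Literature.NumberTheory.EllipticCurves.KrizLi2019.TwoPartBSDTwists
import Literature.NumberTheory.EllipticCurves.HeegnerHypothesisKroneckerProofs
import Literature.NumberTheory.EllipticCurves.NeronComponentDataProofs
import Literature.NumberTheory.EllipticCurves.TamagawaRingEquivProofs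
import Literature.NumberTheory.QuadraticFields.KroneckerSplitting
import HarnessLib

/-!
# K4 crux `AdditiveRankZeroAtTwo` (19098), children C3″ (22617) / C1″ (22615): KERNEL data of the Kriz–Li base `92a1 = [0,1,0,2,1]`
# (Cremona 1992 Table 1 «92 A1(A)»: `N = 92 = 2²·23`, `r = 0`, `#T = 3`, `c_p = (3, 1)`, Kodaira `IV, I₁`) over `K = ℚ(√−7)` —
# ellipticity, minimality, `E[2]` irreducible, ADDITIVE at `2` with `ord₂ j = 8`, non-CM, Tate certificate `IV` at `2` (`f₂ = 2`,
# `c₂ ∣ 3` odd), `N = 92` EXACTLY; the partner `92a1^{(−7)} = [0,−7,0,98,−343]` (`IV` at `2`, `I₀*` at `7`, `I₁` at `23`: `N = 4508 < 5000`)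

Cell `bsd-2adic`, seat `bsd-2adic-k4-w2` GEN 7 (prover, explicit unit, no kit); `--supports stmt-BirchSwinnertonDyer-22617 --as helper`;
companion of the generic road `…AdditivePotGoodPrintKrizLi.lean` and of `…PrintKrizLi44a1Base.lean` (same layout). HONEST FRAMING
(D-0036/D-0054): kernel theorems only (0 `def`, 0 `sorry`, no named fact): everything Kriz–Li 2019 Thm 5.1 (2) needs about the row
`92a1 | −7 | 3 | ✓` of their Table 2 EXCEPT Assumption (★) and the optimal parametrisation (print: `KrizLi2019.table2_row92a1`; ARS for the
odd Manin constant) and EXCEPT `BSD(92a1, 2)`, `BSD(92a1^{(−7)}, 2)` (print: Creutz–Miller, conductors `92`, `4508 < 5000` — certified HERE).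
`92a1` is also a NEW base for GEN 6's Zhai 2016 Thm 1.1 road (`Δ < 0`, `ord₂ j = 8` in the window): that instance rides in the road file.
Tate certificates: the b2b cell's kernel engines (`Rank2Observatory.Tate.Step2Cert` Steps 1–5 for `IV`; `DeepCert` Steps 6–10 for `I₀*`).
Closes nothing; nothing booked; BSD is not proved by any of this.

References: [KrizLi2019] Thm 5.1 (2), Def 4.1, §6 Table 2 (row 92a1); [Silverman1994] IV.9.4, IV.11.1; [SilvermanAEC2009] VII.1, VII.5, III.2.3;
[CremonaAlgorithms1997] Table 1 (92A1; held scan p. 134); [Kraus1989] Prop. 1–2.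
-/

set_option autoImplicit false
-- the Theorems namespace of this sub repeats the summit name by design (D-0017 nested layout)
set_option linter.dupNamespace false

noncomputable section

open scoped Classical NumberField

open WeierstrassCurve IsDedekindDomain Rat.HeightOneSpectrum Literature.NumberTheory.EllipticCurves
  Literature.NumberTheory.EllipticCurves.ModularForms
  Literature.NumberTheory.EllipticCurves.Rank1Residual
  Literature.NumberTheory.DiophantineGeometry
  Summit.BirchSwinnertonDyer
  Summit.BirchSwinnertonDyer.Rank1Residual
  Summit.BirchSwinnertonDyer.Rank1Residual.X11b
  Summit.BirchSwinnertonDyer.Rank1Residual.X5.O1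
  Summit.BirchSwinnertonDyer.Rank1Residual.P2
  Summit.BirchSwinnertonDyer.BirchSwinnertonDyer.Rank1Residual.IntModel
  Summit.BirchSwinnertonDyer.BirchSwinnertonDyer.Theorems
  Summit.BirchSwinnertonDyer.BirchSwinnertonDyer.Rank2Observatory.Tate

namespace Summit.BirchSwinnertonDyer.BirchSwinnertonDyer.Theorems.AddPotGoodPrint

/-! ## §1 Base `92A1 = [0, 1, 0, 2, 1]`: `Δ = −368 = −2⁴·23` (−), `c₄ = −80`, `j = 2⁸·5³/23` (`ord₂ j = 8`) -/
section Base92A1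

/-- `92a1 = [0, 1, 0, 2, 1]` is an elliptic curve (`Δ = −368 ≠ 0`). [cite: CremonaAlgorithms1997, Table 1] -/
theorem isElliptic_92A1 : (⟨0, 1, 0, 2, 1⟩ : WeierstrassCurve ℚ).IsElliptic := ⟨by
  rw [isUnit_iff_ne_zero]; norm_num [WeierstrassCurve.Δ, WeierstrassCurve.b₂, WeierstrassCurve.b₄, WeierstrassCurve.b₆, WeierstrassCurve.b₈]⟩

/-- `92a1` is GLOBALLY MINIMAL (`|Δ| = 368 = 2⁴·23`: `v_p Δ < 12` at every prime). [cite: SilvermanAEC2009, VII.1 Remark 1.1] [cite: Kraus1989, Prop. 1 and Prop. 2] -/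
theorem isGloballyMinimal_92A1 : (⟨0, 1, 0, 2, 1⟩ : WeierstrassCurve ℚ).IsGloballyMinimal :=
  isGloballyMinimal_of_krausCriterion_support (0) (1) (0) (2) (1) [(2, 0, 4), (23, 0, 1)]
    (by intro t ht; simp only [List.mem_cons, List.not_mem_nil, or_false] at ht
        rcases ht with rfl | rfl <;> norm_num)
    (by decide +kernel) (by decide +kernel)

/-- `Δ(92a1) = −368` on the integer model. [cite: CremonaAlgorithms1997, Table 1] -/
theorem M92A1_Δ : (⟨0, 1, 0, 2, 1⟩ : WeierstrassCurve ℤ).Δ = -368 := by decide +kernel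
/-- `c₄(92a1) = −80` on the integer model. [cite: CremonaAlgorithms1997, Table 1] -/
theorem M92A1_c₄ : (⟨0, 1, 0, 2, 1⟩ : WeierstrassCurve ℤ).c₄ = -80 := by decide +kernel
/-- `Δ(92a1) < 0` (rational model). [cite: CremonaAlgorithms1997, Table 1] -/
theorem Δ_sign_92A1 : (⟨0, 1, 0, 2, 1⟩ : WeierstrassCurve ℚ).Δ < 0 := by
  norm_num [WeierstrassCurve.Δ, WeierstrassCurve.b₂, WeierstrassCurve.b₄, WeierstrassCurve.b₆, WeierstrassCurve.b₈]

/-- The integer model of `92a1` is Cremona's. [cite: SilvermanAEC2009, VIII.8] -/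
theorem intModel_92A1 :
    haveI := isElliptic_92A1; haveI := isGloballyMinimal_92A1
    integralModelInt (⟨0, 1, 0, 2, 1⟩ : WeierstrassCurve ℚ) = (⟨0, 1, 0, 2, 1⟩ : WeierstrassCurve ℤ) :=
  haveI := isElliptic_92A1; haveI := isGloballyMinimal_92A1
  integralModelInt_eq_of_map_eq _ (by ext <;> simp [WeierstrassCurve.map])

/-- The integer model base-changed to `ℚ` is the rational model. [folklore] -/
theorem baseChange_int_92A1 : (⟨0, 1, 0, 2, 1⟩ : WeierstrassCurve ℤ).baseChange ℚ = (⟨0, 1, 0, 2, 1⟩ : WeierstrassCurve ℚ) := by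
  ext <;> simp [WeierstrassCurve.baseChange, WeierstrassCurve.map]

/-- `b₂, b₄, b₆` of `92a1`. [cite: SilvermanAEC2009, III.1] -/
theorem b_92A1 : (⟨0, 1, 0, 2, 1⟩ : WeierstrassCurve ℚ).b₂ = ((4 : ℤ) : ℚ) ∧ (⟨0, 1, 0, 2, 1⟩ : WeierstrassCurve ℚ).b₄ = ((4 : ℤ) : ℚ) ∧
    (⟨0, 1, 0, 2, 1⟩ : WeierstrassCurve ℚ).b₆ = ((4 : ℤ) : ℚ) := by
  simp only [WeierstrassCurve.b₂, WeierstrassCurve.b₄, WeierstrassCurve.b₆]; norm_num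

/-- **`E[2]` irreducible for `92a1`** (`E(ℚ)[2] = 0`; Cremona `#T = 3`): the monic `2`-division cubic `X³ + 4X² + 32X + 64` has no root
modulo `3`. [cite: SilvermanAEC2009, III.2.3 (b)] [cite: KrizLi2019, Thm. 5.1 (hypothesis E(ℚ)[2] = 0)] -/
theorem irr_two_92A1 :
    haveI := isElliptic_92A1
    Irr (⟨0, 1, 0, 2, 1⟩ : WeierstrassCurve ℚ) 2 :=
  haveI := isElliptic_92A1
  irr_two_of_forall_cubic_ne _ b_92A1.1 b_92A1.2.1 b_92A1.2.2 (ℓ := 3) (by decide)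

/-- **`ord₂ j(92a1) = 8`** (`2⁴ ∥ c₄ = −80`, `2⁴ ∥ Δ`): INSIDE the window `[1, 11]` (so every twist is additive at `2` by `habitat_twist_of_jWindow`).
[cite: SilvermanAEC2009, III.1 and VII.5 Prop. 5.5] -/
theorem padicValRat_j_92A1 :
    haveI := isElliptic_92A1
    padicValRat 2 (⟨0, 1, 0, 2, 1⟩ : WeierstrassCurve ℚ).j = 8 := by
  haveI : Fact (Nat.Prime 2) := ⟨Nat.prime_two⟩
  haveI := isElliptic_92A1; haveI := isGloballyMinimal_92A1
  rw [AdditivePotMult.padicValRat_j_eq_of_intModel intModel_92A1 2 4 4 (by rw [M92A1_c₄]; decide) (by rw [M92A1_c₄]; decide)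
    (by rw [M92A1_Δ]; decide) (by rw [M92A1_Δ]; decide)]
  norm_num

/-- **`N(92a1) ∣ |Δ_min| = 368`.** [cite: SilvermanAEC2009, VIII.11 and C.16] -/
theorem conductorNorm_dvd_92A1 :
    haveI := isElliptic_92A1
    (⟨0, 1, 0, 2, 1⟩ : WeierstrassCurve ℚ).conductorNorm ℤ ∣ 368 := by
  haveI := isElliptic_92A1; haveI := isGloballyMinimal_92A1
  have hdvd := WeierstrassCurve.conductorNorm_dvd_minimalDiscriminantNorm (⟨0, 1, 0, 2, 1⟩ : WeierstrassCurve ℚ)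
    (WeierstrassCurve.finite_setOf_ordMinimalDiscriminant_ne_zero_holds _)
  rw [WeierstrassCurve.minimalDiscriminantNorm_int_eq_natAbs_minimalDiscriminantInt_holds,
    minimalDiscriminantInt_eq intModel_92A1, M92A1_Δ] at hdvd
  exact hdvd

/-- **`N(92a1) ≤ 130000`** (`N ∣ 368`) — the level bound feeding Agashe–Ribet–Stein Thm. 2.6. [cite: AgasheRibetStein2006, Thm. 2.6] -/
theorem conductorNorm_le_92A1 :
    haveI := isElliptic_92A1
    (⟨0, 1, 0, 2, 1⟩ : WeierstrassCurve ℚ).conductorNorm ℤ ≤ 130000 :=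
  le_trans (Nat.le_of_dvd (by norm_num) conductorNorm_dvd_92A1) (by norm_num)

/-- **`92a1` is non-CM**: multiplicative at `23` (`23 ∣ Δ`, `23 ∤ c₄`), so `ord₂₃ j < 0` and `j` is not a CM invariant. [cite: SilvermanAEC2009, App. C §11] -/
theorem not_hasCM_92A1 :
    haveI := isElliptic_92A1
    ¬ (⟨0, 1, 0, 2, 1⟩ : WeierstrassCurve ℚ).HasCM := by
  haveI : Fact (Nat.Prime 2) := ⟨Nat.prime_two⟩
  haveI := isElliptic_92A1; haveI := isGloballyMinimal_92A1
  haveI : Fact (Nat.Prime 23) := ⟨by norm_num⟩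
  exact AdditivePotMult.not_hasCM_of_padicValRat_j_neg (p := 23) (EisensteinPrimes.padicValRat_j_neg_of_mult _ 23
    (hasMultiplicativeReductionAtPrime_of_intModel intModel_92A1 23 (by rw [M92A1_Δ]; decide) (by rw [M92A1_c₄]; decide)))

/-- **`92a1` is ADDITIVE at `2`** (`2 ∣ Δ`, `2 ∣ c₄` on the minimal model; Kodaira `IV`). [cite: SilvermanAEC2009, VII.5 Prop. 5.1 (c)] -/
theorem addv_two_92A1 :
    haveI := isElliptic_92A1; haveI := isGloballyMinimal_92A1; haveI : Fact (Nat.Prime 2) := ⟨Nat.prime_two⟩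
    Addv (⟨0, 1, 0, 2, 1⟩ : WeierstrassCurve ℚ) 2 := by
  haveI : Fact (Nat.Prime 2) := ⟨Nat.prime_two⟩
  haveI := isElliptic_92A1; haveI := isGloballyMinimal_92A1
  exact Additive.addv_of_intModel intModel_92A1 2 (by rw [M92A1_Δ]; decide) (by rw [M92A1_c₄]; decide)

/-- **Tate certificate for `92a1` at `2`, kernel check** (Steps 1–5): translate by `(r,s,t) = (0,0,1)` to `[0,1,2,2,0]` (singular point at
`(0,0)`: `2 ∣ a₃, a₄, a₆, b₂`); Step 5 exit: `4 ∣ a₆`, `8 ∣ b₈ = 0`, `2² ∥ b₆ = 4` — type `IV`, `v₂(Δ) = 4`. [cite: Silverman1994, IV.9.4 Steps 1–5] -/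
theorem tateStep2Check_two_92A1 : Step2Cert.check ⟨2, 0, 0, 1, 4, 4, 2⟩ ⟨0, 1, 0, 2, 1⟩ = true := by
  decide +kernel

/-- **`92a1` has Kodaira type `IV` and `ord₂ Δ_min = 4` at the place above `2`.** [cite: Silverman1994, IV.9.4 Step 5] [cite: CremonaAlgorithms1997, Table 1 (92A1: IV)] -/
theorem kodairaSymbolAt_two_92A1 (v : HeightOneSpectrum (𝓞 ℚ)) (hv : natGenerator v = 2) :
    (⟨0, 1, 0, 2, 1⟩ : WeierstrassCurve ℚ).kodairaSymbolAt v = .IV ∧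
      (⟨0, 1, 0, 2, 1⟩ : WeierstrassCurve ℚ).ordMinimalDiscriminant v = 4 := by
  have h := Step2Cert.sound (W₀ := ⟨0, 1, 0, 2, 1⟩) (c := ⟨2, 0, 0, 1, 4, 4, 2⟩) v hv tateStep2Check_two_92A1
  rw [baseChange_int_92A1] at h
  exact h

/-- **`f₂(92a1) = 2`** (Ogg: `4 + 1 − 3` components of `IV`), hypothesis-free. [cite: Silverman1994, IV.11.1] -/
theorem conductorExponent_two_92A1 (v : HeightOneSpectrum ℤ) (hv : natGenerator v = 2) :
    (⟨0, 1, 0, 2, 1⟩ : WeierstrassCurve ℚ).conductorExponent v = 2 := by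
  have h := Step2Cert.conductorExponent_int_eq (W₀ := ⟨0, 1, 0, 2, 1⟩) (c := ⟨2, 0, 0, 1, 4, 4, 2⟩) v hv tateStep2Check_two_92A1
  rw [baseChange_int_92A1] at h
  exact h

/-- **`ord₂ N(92a1) = 2`, `ord₂₃ N(92a1) = 1`** (the latter: multiplicative at `23`). [cite: Silverman1994, IV.11.1] [cite: BombieriGubler2006, 12.5.9(b)] -/
theorem factorization_conductorNorm_92A1 :
    haveI := isElliptic_92A1
    ((⟨0, 1, 0, 2, 1⟩ : WeierstrassCurve ℚ).conductorNorm ℤ).factorization 2 = 2 ∧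
      ((⟨0, 1, 0, 2, 1⟩ : WeierstrassCurve ℚ).conductorNorm ℤ).factorization 23 = 1 := by
  haveI := isElliptic_92A1; haveI := isGloballyMinimal_92A1
  haveI hE : ((⟨0, 1, 0, 2, 1⟩ : WeierstrassCurve ℤ).baseChange ℚ).IsElliptic := by rw [baseChange_int_92A1]; infer_instance
  have h23 : Nat.Prime 23 := by norm_num
  refine ⟨?_, ?_⟩
  · rw [show (2 : ℕ) = ((⟨2, Nat.prime_two⟩ : Nat.Primes) : ℕ) from rfl, factorization_conductorNorm_primesEquiv_symm]
    exact conductorExponent_two_92A1 _ (congrArg Subtype.val ((primesEquiv (R := ℤ)).apply_symm_apply ⟨2, Nat.prime_two⟩))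
  · set v : HeightOneSpectrum ℤ := (primesEquiv (R := ℤ)).symm ⟨23, h23⟩ with hv
    have hgen : natGenerator v = 23 := congrArg Subtype.val ((primesEquiv (R := ℤ)).apply_symm_apply ⟨23, h23⟩)
    have hmin : ((⟨0, 1, 0, 2, 1⟩ : WeierstrassCurve ℤ).baseChange ℚ).IsMinimalAt v := by
      rw [baseChange_int_92A1]; exact IsGloballyMinimal.isMinimalAt_int _ v
    have h1 : ((⟨0, 1, 0, 2, 1⟩ : WeierstrassCurve ℤ).baseChange ℚ).conductorExponent v = 1 :=
      conductorExponent_eq_one_of_dvd_Δ_of_not_dvd_c₄ hmin (by rw [hgen, M92A1_Δ]; decide) (by rw [hgen, M92A1_c₄]; decide)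
    rw [baseChange_int_92A1] at h1
    rw [show (23 : ℕ) = ((⟨23, h23⟩ : Nat.Primes) : ℕ) from rfl, factorization_conductorNorm_primesEquiv_symm]
    exact h1

/-- A natural number whose only possible prime factors are `2`, `7`, `23` has `q`-exponent `0` at every other `q`. [folklore] -/
theorem factorization_eq_zero_of_two_seven_twentythree (a b c : ℕ) {q : ℕ} (hq2 : q ≠ 2) (hq7 : q ≠ 7) (hq23 : q ≠ 23) :
    (2 ^ a * 7 ^ b * 23 ^ c).factorization q = 0 := by
  by_cases hq : q.Prime
  · refine Nat.factorization_eq_zero_of_not_dvd fun h => ?_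
    rcases (Nat.Prime.dvd_mul hq).mp h with h | h
    · rcases (Nat.Prime.dvd_mul hq).mp h with h | h
      · exact hq2 ((Nat.prime_dvd_prime_iff_eq hq Nat.prime_two).mp (hq.dvd_of_dvd_pow h))
      · exact hq7 ((Nat.prime_dvd_prime_iff_eq hq (by norm_num)).mp (hq.dvd_of_dvd_pow h))
    · exact hq23 ((Nat.prime_dvd_prime_iff_eq hq (by norm_num)).mp (hq.dvd_of_dvd_pow h))
  · exact Nat.factorization_eq_zero_of_not_prime _ hq

/-- **`N(92a1) = 92` IN THE KERNEL** (`N ∣ 2⁴·23`, `ord₂ N = 2`, `ord₂₃ N = 1`). [cite: CremonaAlgorithms1997, Table 1 (92A1)] -/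
theorem conductorNorm_92A1 :
    haveI := isElliptic_92A1
    (⟨0, 1, 0, 2, 1⟩ : WeierstrassCurve ℚ).conductorNorm ℤ = 92 := by
  haveI := isElliptic_92A1
  set N := (⟨0, 1, 0, 2, 1⟩ : WeierstrassCurve ℚ).conductorNorm ℤ with hN
  have hN0 : N ≠ 0 := (conductorNorm_pos_holds _).ne'
  have hle := (Nat.factorization_le_iff_dvd hN0 (by norm_num : (368 : ℕ) ≠ 0)).mpr conductorNorm_dvd_92A1
  obtain ⟨h2, h23⟩ := factorization_conductorNorm_92A1
  have e92 : (92 : ℕ) = 2 ^ 2 * 7 ^ 0 * 23 ^ 1 := by norm_num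
  have eΔ : (368 : ℕ) = 2 ^ 4 * 7 ^ 0 * 23 ^ 1 := by norm_num
  refine Nat.eq_of_factorization_eq hN0 (by norm_num) fun q => ?_
  by_cases hq2 : q = 2
  · subst hq2; rw [h2, e92]; decide +kernel
  by_cases hq23 : q = 23
  · subst hq23; rw [h23, e92]; decide +kernel
  by_cases hq7 : q = 7
  · subst hq7
    have h0 : (368 : ℕ).factorization 7 = 0 := Nat.factorization_eq_zero_of_not_dvd (by norm_num)
    have h7 : N.factorization 7 = 0 := Nat.le_zero.mp (h0 ▸ hle 7)
    rw [h7, e92]; decide +kernel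
  · have hq' := hle q
    rw [eΔ, factorization_eq_zero_of_two_seven_twentythree 4 0 1 hq2 hq7 hq23] at hq'
    rw [e92, factorization_eq_zero_of_two_seven_twentythree 2 0 1 hq2 hq7 hq23]
    exact Nat.le_zero.mp hq'

/-- **`N(92a1) < 5000`** (Creutz–Miller's range). [cite: CreutzMiller2012, Thm. 1.1] -/
theorem conductorNorm_lt_5000_92A1 :
    haveI := isElliptic_92A1
    (⟨0, 1, 0, 2, 1⟩ : WeierstrassCurve ℚ).conductorNorm ℤ < 5000 := by
  rw [conductorNorm_92A1]; norm_num

/-- **`c₂(92a1)` is ODD** (Cremona: `c₂ = 3`): the local Tamagawa number divides the order `3` of the geometric component group of type `IV`.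
[cite: KrizLi2019, Thm. 5.1 (hypothesis "c₂(E) odd") and Table 2 (row 92a1: c₂ = 3)] [cite: Silverman1994, IV.9 Table 4.1 and Cor. 9.2] -/
theorem odd_localTamagawaNumber_two_92A1 :
    haveI := isElliptic_92A1; haveI : Fact (Nat.Prime 2) := ⟨Nat.prime_two⟩
    Odd (((⟨0, 1, 0, 2, 1⟩ : WeierstrassCurve ℚ).baseChange ℚ_[2]).localTamagawaNumber ℤ_[2]) := by
  haveI := isElliptic_92A1
  haveI : Fact (Nat.Prime 2) := ⟨Nat.prime_two⟩
  set v : HeightOneSpectrum (𝓞 ℚ) := (primesEquiv (R := 𝓞 ℚ)).symm ⟨2, Nat.prime_two⟩ with hv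
  have hv2 : (primesEquiv v : ℕ) = 2 := by rw [hv, Equiv.apply_symm_apply]
  have hgen : natGenerator v = 2 := hv2
  rw [localTamagawaNumber_padic_eq_holds (⟨0, 1, 0, 2, 1⟩ : WeierstrassCurve ℚ) v 2 hv2]
  have hdvd := localTamagawaNumber_dvd_componentGroupOrder v (⟨0, 1, 0, 2, 1⟩ : WeierstrassCurve ℚ)
    (nonempty_neronComponentData_holds _ v)
  rw [(kodairaSymbolAt_two_92A1 v hgen).1] at hdvd
  change _ ∣ 3 at hdvd
  rcases (Nat.dvd_prime Nat.prime_three).mp hdvd with h | h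
  · rw [h]; exact odd_one
  · rw [h]; exact ⟨1, rfl⟩

end Base92A1

/-! ## §2 The partner `T′ = 92a1^{(−7)} = [0,−7,0,98,−343]`: global minimal, `N(T′) = 2²·7²·23 = 4508 < 5000` -/
section Partner92A1

/-- **The tree's quadratic twist `92a1^{(−7)}` IS `[0,−7,0,98,−343]`** (`(b₂, b₄, b₆) = (4, 4, 4)`). [cite: SilvermanAEC2009, X.5 Cor. 5.4] -/
theorem quadraticTwist_neg7_92A1 :
    (⟨0, 1, 0, 2, 1⟩ : WeierstrassCurve ℚ).quadraticTwist (-7) = (⟨0, -7, 0, 98, -343⟩ : WeierstrassCurve ℚ) := by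
  ext <;> norm_num [WeierstrassCurve.quadraticTwist, WeierstrassCurve.b₂, WeierstrassCurve.b₄, WeierstrassCurve.b₆]

/-- `T′ = [0,−7,0,98,−343]` is an elliptic curve (`Δ = −2⁴·7⁶·23 ≠ 0`). [cite: SilvermanAEC2009, III.1] -/
theorem isElliptic_T92A1 : (⟨0, -7, 0, 98, -343⟩ : WeierstrassCurve ℚ).IsElliptic := ⟨by
  rw [isUnit_iff_ne_zero]; norm_num [WeierstrassCurve.Δ, WeierstrassCurve.b₂, WeierstrassCurve.b₄, WeierstrassCurve.b₆, WeierstrassCurve.b₈]⟩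

/-- **`T′` is GLOBALLY MINIMAL** (`|Δ| = 2⁴·7⁶·23`: `v_p Δ < 12` everywhere). [cite: SilvermanAEC2009, VII.1 Remark 1.1] [cite: Kraus1989, Prop. 1] -/
theorem isGloballyMinimal_T92A1 : (⟨0, -7, 0, 98, -343⟩ : WeierstrassCurve ℚ).IsGloballyMinimal :=
  isGloballyMinimal_of_krausCriterion_support (0) (-7) (0) (98) (-343) [(2, 0, 4), (7, 0, 6), (23, 0, 1)]
    (by intro t ht; simp only [List.mem_cons, List.not_mem_nil, or_false] at ht
        rcases ht with rfl | rfl | rfl <;> norm_num)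
    (by decide +kernel) (by decide +kernel)

/-- `Δ(T′) = −43294832 = −2⁴·7⁶·23` (integer model). [cite: SilvermanAEC2009, III.1] -/
theorem MT92A1_Δ : (⟨0, -7, 0, 98, -343⟩ : WeierstrassCurve ℤ).Δ = -43294832 := by decide +kernel
/-- `c₄(T′) = −3920 = −2⁴·5·7²` (integer model). [cite: SilvermanAEC2009, III.1] -/
theorem MT92A1_c₄ : (⟨0, -7, 0, 98, -343⟩ : WeierstrassCurve ℤ).c₄ = -3920 := by decide +kernel

/-- The integer model of `T′` base-changed to `ℚ`. [folklore] -/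
theorem baseChange_int_T92A1 : (⟨0, -7, 0, 98, -343⟩ : WeierstrassCurve ℤ).baseChange ℚ = (⟨0, -7, 0, 98, -343⟩ : WeierstrassCurve ℚ) := by
  ext <;> simp [WeierstrassCurve.baseChange, WeierstrassCurve.map]

/-- The integer model of `T′` is its `integralModelInt`. [cite: SilvermanAEC2009, VIII.8] -/
theorem intModel_T92A1 :
    haveI := isElliptic_T92A1; haveI := isGloballyMinimal_T92A1
    integralModelInt (⟨0, -7, 0, 98, -343⟩ : WeierstrassCurve ℚ) = (⟨0, -7, 0, 98, -343⟩ : WeierstrassCurve ℤ) :=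
  haveI := isElliptic_T92A1; haveI := isGloballyMinimal_T92A1
  integralModelInt_eq_of_map_eq _ (by ext <;> simp [WeierstrassCurve.map])

/-- **`N(T′) ∣ |Δ_min(T′)| = 2⁴·7⁶·23`.** [cite: SilvermanAEC2009, VIII.11 and C.16] -/
theorem conductorNorm_dvd_T92A1 :
    haveI := isElliptic_T92A1
    (⟨0, -7, 0, 98, -343⟩ : WeierstrassCurve ℚ).conductorNorm ℤ ∣ 43294832 := by
  haveI := isElliptic_T92A1; haveI := isGloballyMinimal_T92A1
  have hdvd := WeierstrassCurve.conductorNorm_dvd_minimalDiscriminantNorm (⟨0, -7, 0, 98, -343⟩ : WeierstrassCurve ℚ)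
    (WeierstrassCurve.finite_setOf_ordMinimalDiscriminant_ne_zero_holds _)
  rw [WeierstrassCurve.minimalDiscriminantNorm_int_eq_natAbs_minimalDiscriminantInt_holds,
    minimalDiscriminantInt_eq intModel_T92A1, MT92A1_Δ] at hdvd
  exact hdvd

/-- **Tate certificate for `T′` at `2`** (Steps 1–5): `(r,s,t) = (0,0,1)` gives `[0,−7,2,98,−344]`, Step 5 exit (`4 ∣ a₆`, `8 ∣ b₈ = 0`,
`2² ∥ b₆ = −1372`): type `IV`, `v₂(Δ) = 4` (the unramified twist keeps the type). [cite: Silverman1994, IV.9.4 Steps 1–5] -/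
theorem tateStep2Check_two_T92A1 : Step2Cert.check ⟨2, 0, 0, 1, 4, 4, 2⟩ ⟨0, -7, 0, 98, -343⟩ = true := by
  decide +kernel

/-- **Tate certificate for `T′` at `7`** (Step 6): `7 ∣ a₂`, `49 ∣ a₃, a₄`, `343 ∣ a₆`, and the cubic `X³ − X² + 2X − 1` (`(a₂/7, a₄/49, a₆/343)
= (−1, 2, −1)`) has discriminant `−23`, prime to `7` — type `I₀*`, `v₇(Δ) = 6`. [cite: Silverman1994, IV.9.4 Step 6] -/
theorem tateDeepCheck_seven_T92A1 : DeepCert.check ⟨7, 0, 0, 0, 6, 6, 0⟩ ⟨0, -7, 0, 98, -343⟩ = true := by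
  decide +kernel

/-- **`f₂(T′) = 2`** (type `IV`, `v₂(Δ) = 4`), hypothesis-free. [cite: Silverman1994, IV.11.1] -/
theorem conductorExponent_two_T92A1 (v : HeightOneSpectrum ℤ) (hv : natGenerator v = 2) :
    (⟨0, -7, 0, 98, -343⟩ : WeierstrassCurve ℚ).conductorExponent v = 2 := by
  have h := Step2Cert.conductorExponent_int_eq (W₀ := ⟨0, -7, 0, 98, -343⟩) (c := ⟨2, 0, 0, 1, 4, 4, 2⟩) v hv tateStep2Check_two_T92A1
  rw [baseChange_int_T92A1] at h
  exact h

/-- **`f₇(T′) = 2`** (type `I₀*`, `v₇(Δ) = 6`), hypothesis-free. [cite: Silverman1994, IV.11.1] -/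
theorem conductorExponent_seven_T92A1 (v : HeightOneSpectrum ℤ) (hv : natGenerator v = 7) :
    (⟨0, -7, 0, 98, -343⟩ : WeierstrassCurve ℚ).conductorExponent v = 2 := by
  have h := DeepCert.conductorExponent_int_eq' (W₀ := ⟨0, -7, 0, 98, -343⟩) (c := ⟨7, 0, 0, 0, 6, 6, 0⟩) v hv
    tateDeepCheck_seven_T92A1 (by decide +kernel)
  rw [baseChange_int_T92A1] at h
  exact h

/-- **`ord₂ N(T′) = 2`, `ord₇ N(T′) = 2`, `ord₂₃ N(T′) = 1`** (the last: multiplicative at `23`, `23 ∣ Δ`, `23 ∤ c₄ = −3920`).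
[cite: Silverman1994, IV.11.1] [cite: BombieriGubler2006, 12.5.9(b)] -/
theorem factorization_conductorNorm_T92A1 :
    haveI := isElliptic_T92A1
    ((⟨0, -7, 0, 98, -343⟩ : WeierstrassCurve ℚ).conductorNorm ℤ).factorization 2 = 2 ∧
      ((⟨0, -7, 0, 98, -343⟩ : WeierstrassCurve ℚ).conductorNorm ℤ).factorization 7 = 2 ∧
        ((⟨0, -7, 0, 98, -343⟩ : WeierstrassCurve ℚ).conductorNorm ℤ).factorization 23 = 1 := by
  haveI := isElliptic_T92A1; haveI := isGloballyMinimal_T92A1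
  haveI hE : ((⟨0, -7, 0, 98, -343⟩ : WeierstrassCurve ℤ).baseChange ℚ).IsElliptic := by rw [baseChange_int_T92A1]; infer_instance
  have h7 : Nat.Prime 7 := by norm_num
  have h23 : Nat.Prime 23 := by norm_num
  refine ⟨?_, ?_, ?_⟩
  · rw [show (2 : ℕ) = ((⟨2, Nat.prime_two⟩ : Nat.Primes) : ℕ) from rfl, factorization_conductorNorm_primesEquiv_symm]
    exact conductorExponent_two_T92A1 _ (congrArg Subtype.val ((primesEquiv (R := ℤ)).apply_symm_apply ⟨2, Nat.prime_two⟩))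
  · rw [show (7 : ℕ) = ((⟨7, h7⟩ : Nat.Primes) : ℕ) from rfl, factorization_conductorNorm_primesEquiv_symm]
    exact conductorExponent_seven_T92A1 _ (congrArg Subtype.val ((primesEquiv (R := ℤ)).apply_symm_apply ⟨7, h7⟩))
  · set v : HeightOneSpectrum ℤ := (primesEquiv (R := ℤ)).symm ⟨23, h23⟩ with hv
    have hgen : natGenerator v = 23 := congrArg Subtype.val ((primesEquiv (R := ℤ)).apply_symm_apply ⟨23, h23⟩)
    have hmin : ((⟨0, -7, 0, 98, -343⟩ : WeierstrassCurve ℤ).baseChange ℚ).IsMinimalAt v := by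
      rw [baseChange_int_T92A1]; exact IsGloballyMinimal.isMinimalAt_int _ v
    have h1 : ((⟨0, -7, 0, 98, -343⟩ : WeierstrassCurve ℤ).baseChange ℚ).conductorExponent v = 1 :=
      conductorExponent_eq_one_of_dvd_Δ_of_not_dvd_c₄ hmin (by rw [hgen, MT92A1_Δ]; decide) (by rw [hgen, MT92A1_c₄]; decide)
    rw [baseChange_int_T92A1] at h1
    rw [show (23 : ℕ) = ((⟨23, h23⟩ : Nat.Primes) : ℕ) from rfl, factorization_conductorNorm_primesEquiv_symm]
    exact h1

/-- **`N(92a1^{(−7)}) = 4508 = 2²·7²·23` IN THE KERNEL.** [cite: Silverman1994, IV.11.1] -/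
theorem conductorNorm_T92A1 :
    haveI := isElliptic_T92A1
    (⟨0, -7, 0, 98, -343⟩ : WeierstrassCurve ℚ).conductorNorm ℤ = 4508 := by
  haveI := isElliptic_T92A1
  set N := (⟨0, -7, 0, 98, -343⟩ : WeierstrassCurve ℚ).conductorNorm ℤ with hN
  have hN0 : N ≠ 0 := (conductorNorm_pos_holds _).ne'
  have hle := (Nat.factorization_le_iff_dvd hN0 (by norm_num : (43294832 : ℕ) ≠ 0)).mpr conductorNorm_dvd_T92A1
  obtain ⟨h2, h7, h23⟩ := factorization_conductorNorm_T92A1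
  have e4508 : (4508 : ℕ) = 2 ^ 2 * 7 ^ 2 * 23 ^ 1 := by norm_num
  have eΔ : (43294832 : ℕ) = 2 ^ 4 * 7 ^ 6 * 23 ^ 1 := by norm_num
  refine Nat.eq_of_factorization_eq hN0 (by norm_num) fun q => ?_
  by_cases hq2 : q = 2
  · subst hq2; rw [h2, e4508]; decide +kernel
  by_cases hq7 : q = 7
  · subst hq7; rw [h7, e4508]; decide +kernel
  by_cases hq23 : q = 23
  · subst hq23; rw [h23, e4508]; decide +kernel
  · have hq' := hle q
    rw [eΔ, factorization_eq_zero_of_two_seven_twentythree 4 6 1 hq2 hq7 hq23] at hq'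
    rw [e4508, factorization_eq_zero_of_two_seven_twentythree 2 2 1 hq2 hq7 hq23]
    exact Nat.le_zero.mp hq'

/-- **`N(92a1^{(−7)}) = 4508 < 5000`** (Creutz–Miller's range for the rank-one partner). [cite: CreutzMiller2012, Thm. 1.1] -/
theorem conductorNorm_lt_5000_T92A1 :
    haveI := isElliptic_T92A1
    (⟨0, -7, 0, 98, -343⟩ : WeierstrassCurve ℚ).conductorNorm ℤ < 5000 := by
  rw [conductorNorm_T92A1]; norm_num

end Partner92A1

end Summit.BirchSwinnertonDyer.BirchSwinnertonDyer.Theorems.AddPotGoodPrint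

end
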